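import Literature.Analysis.FunctionSpaces.TorusHolderBridge
import Literature.Analysis.FunctionSpaces.HolderNormProofs
import Literature.Analysis.FunctionSpaces.ContDiffHolderAlgebra
import Literature.Analysis.FunctionSpaces.TorusConvolution
import Literature.Analysis.FunctionSpaces.TorusTestFunction
import Literature.Analysis.FluidPDE.OnsagerBDSVSchauderHigher
import HarnessLib

/-!
# Hölder norms of the slices of a jointly smooth field: uniform bounds and continuity in time

Analysis/FluidPDE support file (everything proved; no definitions). For a field
`w : ℝ → T^d → Y` jointly smooth on `[a, b] × T^d` (`Torus.IsSmoothSpaceTimeOn`), the accepted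
Hölder norms of the slices, `‖w(s)‖_{k,r} = Torus.eContDiffHolderNorm k r (w s)` (`r ≤ 1`), are

* **bounded uniformly in `s ∈ [a, b]`** (`IsSmoothSpaceTimeOn.exists_forall_eContDiffHolderNorm_le`),
* **continuous in `s`** as real numbers (`IsSmoothSpaceTimeOn.continuousOn_toReal_eContDiffHolderNorm`;
  quantitatively `‖w(s) - w(t)‖_{k,r} → 0` as `s → t`,
  `IsSmoothSpaceTimeOn.eventually_eContDiffHolderNorm_sub_le`).

Both follow by induction on `k` from `‖g‖_{k+1,r} ≤ ‖g‖_∞ + Σᵢ ‖∂ᵢg‖_{k,r}`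
(`BDSV.eContDiffHolderNorm_succ_le_sum`) and the order-zero bound
`‖g‖_{0,r} ≤ ‖g‖_∞ + (Σᵢ ‖∂ᵢg‖_∞ + 2‖g‖_∞)` (the lift is Lipschitz with constant `Σᵢ‖∂ᵢg‖_∞`,
and Lipschitz bounded maps are `r`-Hölder for `r ≤ 1`), applied to the slices and to the
differences `w(s) - w(t)` of the jointly smooth partial-derivative fields, which are bounded on the
compact `[a, b] × T^d` and uniformly continuous in time (tube lemma,
`IsSmoothSpaceTimeOn.eventually_norm_sub_lt`).

These are the two qualitative facts about `t ↦ ‖u(t)‖_{N+α}` used by continuity ("bootstrap")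
arguments for a priori estimates of smooth solutions, e.g. BDSV 2019, proof of Prop. 3.1 (the
discharge of `Torus.eulerHolderPropagation`).

## References

* T. Buckmaster, C. De Lellis, L. Székelyhidi Jr., V. Vicol, *Onsager's conjecture for admissible
  weak solutions*, CPAM 72 (2019) = arXiv:1701.08678, App. A (Hölder norms), §3.1.
  [`BuckmasterEtAl2018`]
* D. Gilbarg, N. Trudinger, *Elliptic PDE of second order* (2001), §4.1 (`C¹ ⊂ C^{0,α}`).
-/

noncomputable section

open MeasureTheory Set Filter Function
open scoped NNReal ENNReal ContDiff Topology

namespace Literature.Analysis.FluidPDE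

namespace Torus

open FunctionSpaces FunctionSpaces.Torus

variable {d : Type} [Fintype d] [DecidableEq d] {Y : Type} [NormedAddCommGroup Y] [NormedSpace ℝ Y]

/-! ## The order-zero bound from `C¹` bounds -/

/-- **`‖g‖_{0,r} ≤ M₀ + (Σᵢ Mᵢ + 2M₀)`** for a `C¹` function on `T^d` with `‖g‖ ≤ M₀` and
`‖∂ᵢg‖ ≤ Mᵢ`, `r ≤ 1` (accepted norm `Torus.eContDiffHolderNorm 0 r = ‖·‖_∞ + [lift ·]_r`; the
lift is `Σᵢ Mᵢ`-Lipschitz, `Torus.norm_fderiv_lift_le_of_norm_partialDeriv_le`, and bounded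
Lipschitz maps are `r`-Hölder, `LipschitzWith.holderWith_of_enorm_le`).
[cite: GilbargTrudinger2001, §4.1] -/
theorem eContDiffHolderNorm_zero_le_of_bounds {g : UnitAddTorus d → Y} (hg : IsContDiff 1 g)
    {r : ℝ≥0} (hr : r ≤ 1) {M₀ : ℝ} {M : d → ℝ} (hM₀ : 0 ≤ M₀) (hM : ∀ i, 0 ≤ M i)
    (h0 : ∀ x, ‖g x‖ ≤ M₀) (h : ∀ i x, ‖partialDeriv i g x‖ ≤ M i) :
    Torus.eContDiffHolderNorm 0 r g ≤ ENNReal.ofReal (M₀ + ((∑ i, M i) + 2 * M₀)) := by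
  rw [Torus.eContDiffHolderNorm, eContDiffHolderNorm_zero_eq, eSupNorm_lift]
  have hsum : 0 ≤ ∑ i, M i := Finset.sum_nonneg fun i _ => hM i
  -- the lift is Lipschitz and bounded
  have hlip : LipschitzWith (∑ i, M i).toNNReal (lift g) := by
    refine lipschitzWith_of_nnnorm_fderiv_le (hg.differentiable one_ne_zero) fun a => ?_
    have h1 := norm_fderiv_lift_le_of_norm_partialDeriv_le hg h a
    rw [← NNReal.coe_le_coe, coe_nnnorm, Real.coe_toNNReal _ hsum]
    exact h1
  have hbd : ∀ a, ‖lift g a‖ₑ ≤ M₀.toNNReal := fun a => by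
    rw [lift_apply, ← ofReal_norm, ← ENNReal.ofReal_coe_nnreal, Real.coe_toNNReal _ hM₀]
    exact ENNReal.ofReal_le_ofReal (h0 _)
  have hH := (hlip.holderWith_of_enorm_le hbd hr).eHolderNorm_le
  have hS : eSupNorm g ≤ ENNReal.ofReal M₀ := eSupNorm_le_ofReal h0
  calc eSupNorm g + eHolderNorm r (lift g)
      ≤ ENNReal.ofReal M₀ + ((∑ i, M i).toNNReal + 2 * M₀.toNNReal : ℝ≥0) := add_le_add hS hH
    _ = ENNReal.ofReal (M₀ + ((∑ i, M i) + 2 * M₀)) := by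
        rw [ENNReal.ofReal_add hM₀ (by positivity), ENNReal.ofReal_add hsum (by positivity),
          ENNReal.ofReal_mul (by norm_num), ENNReal.ofReal_ofNat]
        simp only [ENNReal.ofReal, ENNReal.coe_add, ENNReal.coe_mul, ENNReal.coe_ofNat]

variable {a b : ℝ} {r : ℝ≥0}

/-! ## Uniform bounds in time -/

/-- **Uniform Hölder bounds for the slices of a jointly smooth field.** For `w` jointly smooth on
`[a, b] × T^d` (`a < b`), `r ≤ 1` and every `k`, the norms `‖w(s)‖_{k,r}` are bounded uniformly
in `s ∈ [a, b]`. [folklore] -/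
theorem _root_.Literature.Analysis.FunctionSpaces.Torus.IsSmoothSpaceTimeOn.exists_forall_eContDiffHolderNorm_le
    (hab : a < b) (hr : r ≤ 1) (k : ℕ) :
    ∀ {w : ℝ → UnitAddTorus d → Y}, IsSmoothSpaceTimeOn (Icc a b) w →
      ∃ B : ℝ, 0 ≤ B ∧ ∀ s ∈ Icc a b, Torus.eContDiffHolderNorm k r (w s) ≤ ENNReal.ofReal B := by
  have hS : UniqueDiffOn ℝ (Icc a b) := uniqueDiffOn_Icc hab
  induction k with
  | zero =>
    intro w hw
    obtain ⟨C₀, hC₀⟩ := hw.exists_norm_le_of_isCompact isCompact_Icc subset_rfl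
    choose C hC using fun i => (hw.partialDeriv hS i).exists_norm_le_of_isCompact isCompact_Icc subset_rfl
    have hC₀0 : 0 ≤ max C₀ 0 := le_max_right _ _
    have hsum0 : 0 ≤ ∑ i, max (C i) 0 := Finset.sum_nonneg fun i _ => le_max_right _ _
    refine ⟨max C₀ 0 + ((∑ i, max (C i) 0) + 2 * max C₀ 0), by positivity, fun s hs => ?_⟩
    exact eContDiffHolderNorm_zero_le_of_bounds ((hw.isSmooth_slice hs).isContDiff (by simp)) hr hC₀0
      (fun i => le_max_right _ _) (fun x => (hC₀ s hs x).trans (le_max_left _ _))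
      (fun i x => (hC i s hs x).trans (le_max_left _ _))
  | succ k IH =>
    intro w hw
    obtain ⟨C₀, hC₀⟩ := hw.exists_norm_le_of_isCompact isCompact_Icc subset_rfl
    have hIH : ∀ i, ∃ B : ℝ, 0 ≤ B ∧ ∀ s ∈ Icc a b,
        Torus.eContDiffHolderNorm k r (partialDeriv i (w s)) ≤ ENNReal.ofReal B := fun i =>
      IH (hw.partialDeriv hS i)
    choose B hB0 hB using hIH
    have hsumB : 0 ≤ ∑ i, B i := Finset.sum_nonneg fun i _ => hB0 i
    refine ⟨max C₀ 0 + ∑ i, B i, add_nonneg (le_max_right _ _) hsumB, fun s hs => ?_⟩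
    have hsm : IsSmooth (w s) := hw.isSmooth_slice hs
    calc Torus.eContDiffHolderNorm (k + 1) r (w s)
        ≤ eSupNorm (w s) + ∑ i, Torus.eContDiffHolderNorm k r (partialDeriv i (w s)) :=
          BDSV.eContDiffHolderNorm_succ_le_sum hsm k r
      _ ≤ ENNReal.ofReal (max C₀ 0) + ∑ i, ENNReal.ofReal (B i) :=
          add_le_add (eSupNorm_le_ofReal fun x => (hC₀ s hs x).trans (le_max_left _ _))
            (Finset.sum_le_sum fun i _ => hB i s hs)
      _ = ENNReal.ofReal (max C₀ 0 + ∑ i, B i) := by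
          rw [ENNReal.ofReal_add (le_max_right _ _) (Finset.sum_nonneg fun i _ => hB0 i),
            ENNReal.ofReal_sum_of_nonneg fun i _ => hB0 i]

/-! ## Continuity in time -/

/-- **Time increments are small in every Hölder norm.** For `w` jointly smooth on
`[a, b] × T^d` (`a < b`), `r ≤ 1`, `k`, `t ∈ [a, b]` and `ε > 0`:
`‖w(s) - w(t)‖_{k,r} ≤ ε` for `s` near `t` within `[a, b]`. [folklore] -/
theorem _root_.Literature.Analysis.FunctionSpaces.Torus.IsSmoothSpaceTimeOn.eventually_eContDiffHolderNorm_sub_le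
    (hab : a < b) (hr : r ≤ 1) (k : ℕ) :
    ∀ {w : ℝ → UnitAddTorus d → Y}, IsSmoothSpaceTimeOn (Icc a b) w → ∀ {t : ℝ}, t ∈ Icc a b →
      ∀ {ε : ℝ}, 0 < ε → ∀ᶠ s in 𝓝[Icc a b] t,
        Torus.eContDiffHolderNorm k r (fun x => w s x - w t x) ≤ ENNReal.ofReal ε := by
  have hS : UniqueDiffOn ℝ (Icc a b) := uniqueDiffOn_Icc hab
  induction k with
  | zero =>
    intro w hw t ht ε hε
    set ε' : ℝ := ε / (3 + Fintype.card d) with hε'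
    have hε'0 : 0 < ε' := by positivity
    have h0 := hw.eventually_norm_sub_lt ht hε'0
    have hi : ∀ i, ∀ᶠ s in 𝓝[Icc a b] t, ∀ x,
        ‖partialDeriv i (w s) x - partialDeriv i (w t) x‖ < ε' := fun i =>
      (hw.partialDeriv hS i).eventually_norm_sub_lt ht hε'0
    have hall := (Filter.eventually_all.2 hi).and h0
    filter_upwards [hall, self_mem_nhdsWithin] with s hs hsS
    obtain ⟨hs1, hs0⟩ := hs
    have hsm : IsContDiff 1 (fun x => w s x - w t x) :=
      ((hw.isSmooth_slice hsS).sub (hw.isSmooth_slice ht)).isContDiff (by simp)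
    have hws : IsContDiff 1 (w s) := (hw.isSmooth_slice hsS).isContDiff (by simp)
    have hwt : IsContDiff 1 (w t) := (hw.isSmooth_slice ht).isContDiff (by simp)
    refine (eContDiffHolderNorm_zero_le_of_bounds hsm hr hε'0.le (fun _ => hε'0.le)
      (fun x => (hs0 x).le) (fun i x => ?_)).trans (le_of_eq ?_)
    · rw [partialDeriv_sub_at hws hwt]
      exact (hs1 i x).le
    · congr 1
      rw [Finset.sum_const, Finset.card_univ, nsmul_eq_mul, hε']
      field_simp
      ring
  | succ k IH =>
    intro w hw t ht ε hε
    set ε' : ℝ := ε / (1 + Fintype.card d) with hε'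
    have hε'0 : 0 < ε' := by positivity
    have h0 := hw.eventually_norm_sub_lt ht hε'0
    have hi : ∀ i, ∀ᶠ s in 𝓝[Icc a b] t,
        Torus.eContDiffHolderNorm k r (fun x => partialDeriv i (w s) x - partialDeriv i (w t) x) ≤
          ENNReal.ofReal ε' := fun i =>
      IH (hw.partialDeriv hS i) ht hε'0
    have hall := (Filter.eventually_all.2 hi).and h0
    filter_upwards [hall, self_mem_nhdsWithin] with s hs hsS
    obtain ⟨hs1, hs0⟩ := hs
    have hsm : IsSmooth (fun x => w s x - w t x) := (hw.isSmooth_slice hsS).sub (hw.isSmooth_slice ht)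
    have hws : IsContDiff 1 (w s) := (hw.isSmooth_slice hsS).isContDiff (by simp)
    have hwt : IsContDiff 1 (w t) := (hw.isSmooth_slice ht).isContDiff (by simp)
    have hpd : ∀ i, partialDeriv i (fun x => w s x - w t x) =
        fun x => partialDeriv i (w s) x - partialDeriv i (w t) x := fun i =>
      funext fun x => partialDeriv_sub_at hws hwt i x
    calc Torus.eContDiffHolderNorm (k + 1) r (fun x => w s x - w t x)
        ≤ eSupNorm (fun x => w s x - w t x) +
            ∑ i, Torus.eContDiffHolderNorm k r (partialDeriv i (fun x => w s x - w t x)) :=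
          BDSV.eContDiffHolderNorm_succ_le_sum hsm k r
      _ ≤ ENNReal.ofReal ε' + ∑ _i : d, ENNReal.ofReal ε' := by
          refine add_le_add (eSupNorm_le_ofReal fun x => (hs0 x).le) (Finset.sum_le_sum fun i _ => ?_)
          rw [hpd i]
          exact hs1 i
      _ = ENNReal.ofReal ε := by
          rw [Finset.sum_const, Finset.card_univ, nsmul_eq_mul, ← ENNReal.ofReal_natCast,
            ← ENNReal.ofReal_mul (Nat.cast_nonneg _), ← ENNReal.ofReal_add hε'0.le (by positivity)]
          congr 1
          rw [hε']
          field_simp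

/-- **Continuity in time of the Hölder norms of the slices.** For `w` jointly smooth on
`[a, b] × T^d` (`a < b`), `r ≤ 1` and every `k`, `s ↦ ‖w(s)‖_{k,r}` is continuous on `[a, b]`
as a real-valued function (the norms are finite for smooth slices). [folklore] -/
theorem _root_.Literature.Analysis.FunctionSpaces.Torus.IsSmoothSpaceTimeOn.continuousOn_toReal_eContDiffHolderNorm
    {w : ℝ → UnitAddTorus d → Y} (hw : IsSmoothSpaceTimeOn (Icc a b) w) (hab : a < b) (hr : r ≤ 1)
    (k : ℕ) :
    ContinuousOn (fun s => (Torus.eContDiffHolderNorm k r (w s)).toReal) (Icc a b) := by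
  intro t ht
  rw [ContinuousWithinAt, Metric.tendsto_nhds]
  intro ε hε
  have hε2 : 0 < ε / 2 := half_pos hε
  filter_upwards [hw.eventually_eContDiffHolderNorm_sub_le hab hr k ht hε2, self_mem_nhdsWithin]
    with s hs hsS
  have hws : IsSmooth (w s) := hw.isSmooth_slice hsS
  have hwt : IsSmooth (w t) := hw.isSmooth_slice ht
  have hk : ∀ {g : UnitAddTorus d → Y}, IsSmooth g → IsContDiff k g := fun hg =>
    hg.isContDiff (by exact_mod_cast le_top)
  have hfs : Torus.eContDiffHolderNorm k r (w s) ≠ ⊤ := (hws.eContDiffHolderNorm_lt_top k hr).ne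
  have hft : Torus.eContDiffHolderNorm k r (w t) ≠ ⊤ := (hwt.eContDiffHolderNorm_lt_top k hr).ne
  -- the two triangle inequalities
  have h1 : Torus.eContDiffHolderNorm k r (w s) ≤
      Torus.eContDiffHolderNorm k r (w t) + ENNReal.ofReal (ε / 2) := by
    have heq : w s = w t + fun x => w s x - w t x := by funext x; simp
    calc Torus.eContDiffHolderNorm k r (w s)
        = Torus.eContDiffHolderNorm k r (w t + fun x => w s x - w t x) := by rw [← heq]
      _ ≤ Torus.eContDiffHolderNorm k r (w t) + Torus.eContDiffHolderNorm k r (fun x => w s x - w t x) :=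
          Torus.eContDiffHolderNorm_add_le (hk hwt) (hk (hws.sub hwt))
      _ ≤ Torus.eContDiffHolderNorm k r (w t) + ENNReal.ofReal (ε / 2) := add_le_add le_rfl hs
  have h2 : Torus.eContDiffHolderNorm k r (w t) ≤
      Torus.eContDiffHolderNorm k r (w s) + ENNReal.ofReal (ε / 2) := by
    have heq : w t = w s + fun x => -(w s x - w t x) := by funext x; simp
    have hneg : Torus.eContDiffHolderNorm k r (fun x => -(w s x - w t x)) =
        Torus.eContDiffHolderNorm k r (fun x => w s x - w t x) :=
      Torus.eContDiffHolderNorm_neg k r (fun x => w s x - w t x)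
    calc Torus.eContDiffHolderNorm k r (w t)
        = Torus.eContDiffHolderNorm k r (w s + fun x => -(w s x - w t x)) := by rw [← heq]
      _ ≤ Torus.eContDiffHolderNorm k r (w s) + Torus.eContDiffHolderNorm k r (fun x => -(w s x - w t x)) :=
          Torus.eContDiffHolderNorm_add_le (hk hws) (hk (hws.sub hwt).neg)
      _ ≤ Torus.eContDiffHolderNorm k r (w s) + ENNReal.ofReal (ε / 2) := by
          rw [hneg]; exact add_le_add le_rfl hs
  -- pass to reals
  have h1' := ENNReal.toReal_mono (ENNReal.add_ne_top.2 ⟨hft, ENNReal.ofReal_ne_top⟩) h1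
  have h2' := ENNReal.toReal_mono (ENNReal.add_ne_top.2 ⟨hfs, ENNReal.ofReal_ne_top⟩) h2
  rw [ENNReal.toReal_add hft ENNReal.ofReal_ne_top, ENNReal.toReal_ofReal hε2.le] at h1'
  rw [ENNReal.toReal_add hfs ENNReal.ofReal_ne_top, ENNReal.toReal_ofReal hε2.le] at h2'
  rw [Real.dist_eq, abs_lt]
  constructor <;> linarith

end Torus

end Literature.Analysis.FluidPDE
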